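import Literature.NumberTheory.LFunctions.TuringMethod
import Literature.NumberTheory.LFunctions.RiemannZetaChiTheta
import Literature.NumberTheory.LFunctions.ApproxFunctionalEquationSharp
import Literature.NumberTheory.LFunctions.RiemannSiegelStirling
import Literature.NumberTheory.LFunctions.TitchmarshLemma921
import Literature.NumberTheory.LFunctions.TwistedMomentSums
import HarnessLib

/-!
# `Z(t) = z₁(t) + z̄₁(t) + e(t)`: Hardy's function and the main sum of fixed length

Topic `Literature/NumberTheory/LFunctions`.

Titchmarsh, *The Theory of the Riemann Zeta-Function*, §9.20 (after Selberg 1942): by the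
approximate functional equation (4.17.1)–(4.17.4),
`Z(t) = z(t) + z̄(t) + O(t^{-1/4})`, `z(t) = (t/2πe)^{it/2} e^{-iπ/8} ∑_{n ≤ x} n^{-1/2-it}`,
`x = (t/2π)^{1/2}`, and for `T ≤ t ≤ T + U`, `τ = (T/2π)^{1/2}`, one puts
`z₁(t) = (t/2πe)^{it/2} e^{-iπ/8} ∑_{n ≤ τ} n^{-1/2-it}` (a Dirichlet polynomial of fixed length)
and `Z = z₁ + z̄₁ + e`.

This file DEFINES the three players

* `Literature.NumberTheory.LFunctions.TwistedMoment.mainSum P t = ∑_{n ≤ P} n^{-1/2-it}`,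
* `Literature.NumberTheory.LFunctions.TwistedMoment.thetaMainPhase t = e^{i(t/2 log(t/2π) − t/2 − π/8)}`
  (the main term of `e^{iϑ(t)}`, so that `z₁ = thetaMainPhase · mainSum P`),
* `Literature.NumberTheory.LFunctions.TwistedMoment.hardyZErr P t = Z(t) − z₁(t) − z̄₁(t)`,

and PROVES the pointwise bound behind (9.20.6)–(9.20.7):

* `Literature.NumberTheory.LFunctions.TwistedMoment.norm_hardyZErr_le` — there are `C₁ > 0`, `t₁`
  with `‖e(t)‖ ≤ 2 ‖∑_{P < n ≤ x(t)} n^{-1/2-it}‖ + C₁ t^{-1/4}` for `t ≥ t₁`, `2πP² ≤ t`, from the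
  tree's approximate functional equation
  (`Literature.NumberTheory.LFunctions.AFE.approxFunctionalEq_half_chi_sharp`), the identity
  `e^{iϑ} χ(1/2+it) = e^{-iϑ}` (`Literature.NumberTheory.LFunctions.cexp_theta_mul_riemannZetaChi_half`)
  and the Stirling bound for `ϑ` (`Literature.NumberTheory.LFunctions.abs_riemannSiegelTheta_sub_stirling_le`).

## References

* E. C. Titchmarsh, *The Theory of the Riemann Zeta-Function*, 2nd ed. (rev. D. R. Heath-Brown),
  Oxford 1986, §4.17 and §9.20, eqs. (9.20.6)–(9.20.7). [cite: Titchmarsh1986, §9.20]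
* A. Selberg, *On the zeros of Riemann's zeta-function*, Skr. Norske Vid.-Akad. Oslo I 1942, no. 10.
-/

noncomputable section

open Finset Real Complex MeasureTheory intervalIntegral
open scoped ComplexConjugate

namespace Literature.NumberTheory.LFunctions.TwistedMoment

/-! ### Definitions -/

/-- The **main sum** `S_P(t) = ∑_{n ≤ P} n^{-1/2-it}` of the approximate functional equation on the
critical line, written with real powers and phases: `∑_{n=1}^{P} n^{-1/2} e^{-it log n}`.
(Titchmarsh §4.17, §9.20: `z₁(t) = (t/2πe)^{it/2} e^{-iπ/8} S_τ(t)`.) [cite: Titchmarsh1986, §9.20] -/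
def mainSum (P : ℕ) (t : ℝ) : ℂ :=
  ∑ n ∈ Finset.Icc 1 P, (((n : ℝ) ^ (-(1 / 2 : ℝ)) : ℝ) : ℂ) * cexp (-(I * t * Real.log n))

/-- The **main term of `e^{iϑ(t)}`**: `E₁(t) = e^{i(t/2 · log(t/2π) − t/2 − π/8)} = (t/2πe)^{it/2} e^{-iπ/8}`
(Titchmarsh §9.20: `e^{iϑ} = (t/2πe)^{it/2} e^{-iπ/8} {1 + O(1/t)}`). [cite: Titchmarsh1986, §9.20] -/
def thetaMainPhase (t : ℝ) : ℂ :=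
  cexp (I * ((t / 2 * Real.log (t / (2 * π)) - t / 2 - π / 8 : ℝ) : ℂ))

/-- The **error `e(t) = Z(t) − z₁(t) − z̄₁(t)`** of Titchmarsh §9.23 ("Let `Z(t) = z₁(t) + z̄₁(t) + e(t)`"),
with `z₁(t) = E₁(t) S_P(t)`, `Z` the tree's `Literature.NumberTheory.LFunctions.hardyZ`.
[cite: Titchmarsh1986, §9.23] -/
def hardyZErr (P : ℕ) (t : ℝ) : ℂ :=
  (hardyZ t : ℂ) - thetaMainPhase t * mainSum P t - conj (thetaMainPhase t * mainSum P t)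

/-- Unfolding lemma for `mainSum`. [folklore] -/
theorem mainSum_def (P : ℕ) (t : ℝ) : mainSum P t =
    ∑ n ∈ Finset.Icc 1 P, (((n : ℝ) ^ (-(1 / 2 : ℝ)) : ℝ) : ℂ) * cexp (-(I * t * Real.log n)) := rfl

/-- Unfolding lemma for `thetaMainPhase`. [folklore] -/
theorem thetaMainPhase_def (t : ℝ) : thetaMainPhase t =
    cexp (I * ((t / 2 * Real.log (t / (2 * π)) - t / 2 - π / 8 : ℝ) : ℂ)) := rfl

/-- Unfolding lemma for `hardyZErr`. [folklore] -/
theorem hardyZErr_def (P : ℕ) (t : ℝ) : hardyZErr P t =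
    (hardyZ t : ℂ) - thetaMainPhase t * mainSum P t - conj (thetaMainPhase t * mainSum P t) := rfl

/-! ### The terms `n^{-1/2 ∓ it}` -/

/-- `n^{-1/2-it} = n^{-1/2} e^{-it log n}`. [folklore] -/
theorem natCast_cpow_neg_half_sub_eq {n : ℕ} (hn : 0 < n) (t : ℝ) :
    (n : ℂ) ^ (-(1 / 2 : ℂ) - t * I) = (((n : ℝ) ^ (-(1 / 2 : ℝ)) : ℝ) : ℂ) * cexp (-(I * t * Real.log n)) := by
  have hn0 : (n : ℂ) ≠ 0 := by exact_mod_cast hn.ne'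
  have hnR : (0 : ℝ) ≤ n := Nat.cast_nonneg n
  rw [Complex.cpow_def_of_ne_zero hn0, Complex.ofReal_cpow hnR, ← Complex.natCast_log,
    show ((n : ℝ) : ℂ) = (n : ℂ) by simp, Complex.cpow_def_of_ne_zero hn0, ← Complex.exp_add,
    ← Complex.natCast_log]
  congr 1
  push_cast
  ring

/-- `n^{-1/2+it} = n^{-1/2} e^{it log n}`. [folklore] -/
theorem natCast_cpow_neg_half_add_eq {n : ℕ} (hn : 0 < n) (t : ℝ) :
    (n : ℂ) ^ (-(1 / 2 : ℂ) + t * I) = (((n : ℝ) ^ (-(1 / 2 : ℝ)) : ℝ) : ℂ) * cexp (I * t * Real.log n) := by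
  have hn0 : (n : ℂ) ≠ 0 := by exact_mod_cast hn.ne'
  have hnR : (0 : ℝ) ≤ n := Nat.cast_nonneg n
  rw [Complex.cpow_def_of_ne_zero hn0, Complex.ofReal_cpow hnR, ← Complex.natCast_log,
    show ((n : ℝ) : ℂ) = (n : ℂ) by simp, Complex.cpow_def_of_ne_zero hn0, ← Complex.exp_add,
    ← Complex.natCast_log]
  congr 1
  push_cast
  ring

/-- The first sum of the approximate functional equation is `mainSum`. [folklore] -/
theorem afeSum_eq_mainSum (x : ℕ) (t : ℝ) :
    ∑ n ∈ Finset.Icc 1 x, (n : ℂ) ^ (-(1 / 2 : ℂ) - t * I) = mainSum x t :=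
  Finset.sum_congr rfl fun _ hn => natCast_cpow_neg_half_sub_eq (Finset.mem_Icc.1 hn).1 t

/-- `conj` of a term. [folklore] -/
theorem conj_term (n : ℕ) (t : ℝ) :
    conj ((((n : ℝ) ^ (-(1 / 2 : ℝ)) : ℝ) : ℂ) * cexp (-(I * t * Real.log n))) =
      (((n : ℝ) ^ (-(1 / 2 : ℝ)) : ℝ) : ℂ) * cexp (I * t * Real.log n) := by
  rw [map_mul, Complex.conj_ofReal, ← Complex.exp_conj]
  congr 2
  simp only [map_neg, map_mul, Complex.conj_I, Complex.conj_ofReal]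
  ring

/-- `conj (mainSum P t) = ∑ n^{-1/2} e^{it log n}`. [folklore] -/
theorem conj_mainSum (P : ℕ) (t : ℝ) :
    conj (mainSum P t) = ∑ n ∈ Finset.Icc 1 P, (((n : ℝ) ^ (-(1 / 2 : ℝ)) : ℝ) : ℂ) * cexp (I * t * Real.log n) := by
  rw [mainSum, map_sum]
  exact Finset.sum_congr rfl fun n _ => conj_term n t

/-- The second sum of the approximate functional equation is `conj mainSum`. [folklore] -/
theorem afeSum'_eq_conj_mainSum (x : ℕ) (t : ℝ) :
    ∑ n ∈ Finset.Icc 1 x, (n : ℂ) ^ (-(1 / 2 : ℂ) + t * I) = conj (mainSum x t) := by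
  rw [conj_mainSum]
  exact Finset.sum_congr rfl fun _ hn => natCast_cpow_neg_half_add_eq (Finset.mem_Icc.1 hn).1 t

/-- `‖S_P(t)‖ ≤ 2 P^{1/2}`. [folklore] -/
theorem norm_mainSum_le (P : ℕ) (t : ℝ) : ‖mainSum P t‖ ≤ 2 * Real.sqrt P := by
  refine (norm_sum_le _ _).trans (le_trans (Finset.sum_le_sum fun n hn => ?_) (sum_Icc_rpow_neg_half_le P))
  have hn0 : (0 : ℝ) < n := by exact_mod_cast (Finset.mem_Icc.1 hn).1
  rw [norm_mul, Complex.norm_real, Real.norm_eq_abs, abs_of_nonneg (Real.rpow_nonneg hn0.le _),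
    show -(I * (t : ℂ) * (Real.log n : ℂ)) = ((-(t * Real.log n) : ℝ) : ℂ) * I by push_cast; ring,
    Complex.norm_exp_ofReal_mul_I, mul_one]

/-- `S_k − S_P = ∑_{P < n ≤ k} n^{-1/2-it}` for `P ≤ k`. [folklore] -/
theorem mainSum_sub_mainSum {P k : ℕ} (hPk : P ≤ k) (t : ℝ) :
    mainSum k t - mainSum P t =
      ∑ n ∈ Finset.Icc (P + 1) k, (((n : ℝ) ^ (-(1 / 2 : ℝ)) : ℝ) : ℂ) * cexp (-(I * t * Real.log n)) := by
  rw [mainSum, mainSum, sub_eq_iff_eq_add', ← Finset.Ico_add_one_right_eq_Icc,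
    ← Finset.Ico_add_one_right_eq_Icc, ← Finset.Ico_add_one_right_eq_Icc]
  exact (Finset.sum_Ico_consecutive _ (by omega) (by omega)).symm

/-! ### The phase `E₁` -/

/-- `‖E₁(t)‖ = 1`. [folklore] -/
theorem norm_thetaMainPhase (t : ℝ) : ‖thetaMainPhase t‖ = 1 := by
  rw [thetaMainPhase, show I * (((t / 2 * Real.log (t / (2 * π)) - t / 2 - π / 8 : ℝ)) : ℂ) =
    (((t / 2 * Real.log (t / (2 * π)) - t / 2 - π / 8 : ℝ)) : ℂ) * I by ring, Complex.norm_exp_ofReal_mul_I]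

/-- `E₁(t)² = e^{i(t log(t/2π) − t − π/4)}` (the phase `E₂` of Lemma 9.22). [folklore] -/
theorem thetaMainPhase_mul_self (t : ℝ) : thetaMainPhase t * thetaMainPhase t =
    cexp (I * ((t * Real.log (t / (2 * π)) - t - π / 4 : ℝ) : ℂ)) := by
  rw [thetaMainPhase, ← Complex.exp_add]
  congr 1
  push_cast
  ring

/-- `conj E₁(t) = E₁(t)⁻¹ = e^{-i(…)}`. [folklore] -/
theorem conj_thetaMainPhase (t : ℝ) : conj (thetaMainPhase t) =
    cexp (-(I * ((t / 2 * Real.log (t / (2 * π)) - t / 2 - π / 8 : ℝ) : ℂ))) := by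
  rw [thetaMainPhase, ← Complex.exp_conj]
  congr 1
  simp only [map_mul, Complex.conj_I, Complex.conj_ofReal]
  ring

/-- **`|e^{iϑ(t)} − E₁(t)| ≤ 2K(¼)/t`** for `t ≥ 2` (`|e^{ia} − e^{ib}| ≤ |a − b|` and the Stirling bound
for `ϑ`). [cite: Titchmarsh1986, §4.17] -/
theorem norm_cexp_theta_sub_thetaMainPhase_le {t : ℝ} (ht : 2 ≤ t) :
    ‖cexp (riemannSiegelTheta t * I) - thetaMainPhase t‖ ≤ 2 * stirlingVertRate (1 / 4) / t := by
  have hS := abs_riemannSiegelTheta_sub_stirling_le ht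
  set a := riemannSiegelTheta t with ha
  set b := t / 2 * Real.log (t / (2 * π)) - t / 2 - π / 8 with hb
  have hE : thetaMainPhase t = cexp (b * I) := by rw [thetaMainPhase, hb]; congr 1; ring
  rw [hE]
  have hfac : cexp (a * I) - cexp (b * I) = cexp (b * I) * (cexp (I * (a - b : ℝ)) - 1) := by
    rw [mul_sub, mul_one, ← Complex.exp_add]; congr 2; push_cast; ring
  rw [hfac, norm_mul, Complex.norm_exp_ofReal_mul_I, one_mul]
  refine (Real.norm_exp_I_mul_ofReal_sub_one_le).trans ?_
  rw [Real.norm_eq_abs]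
  exact hS

/-! ### The pointwise bound for `e(t)` -/

/-- The algebra of §9.20: if `ζ(1/2+it) = S + χ S̄ + R` and `e^{iϑ} χ = e^{-iϑ}`, then with
`S = S_P + D`, `Z − E₁ S_P − conj(E₁ S_P) = A + conj A + e^{iϑ} R`,
`A = (e^{iϑ} − E₁) S_P + e^{iϑ} D`. [cite: Titchmarsh1986, §9.20] -/
theorem hardyZErr_eq {P : ℕ} {t : ℝ} (S D R : ℂ) (hZ : (hardyZ t : ℂ) =
      cexp (riemannSiegelTheta t * I) * (S + riemannZetaChi (1 / 2 + t * I) * conj S + R))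
    (hS : S = mainSum P t + D) :
    hardyZErr P t =
      ((cexp (riemannSiegelTheta t * I) - thetaMainPhase t) * mainSum P t + cexp (riemannSiegelTheta t * I) * D)
      + conj ((cexp (riemannSiegelTheta t * I) - thetaMainPhase t) * mainSum P t
          + cexp (riemannSiegelTheta t * I) * D)
      + cexp (riemannSiegelTheta t * I) * R := by
  have hχ := cexp_theta_mul_riemannZetaChi_half t
  have hconjE : conj (cexp (riemannSiegelTheta t * I)) = cexp (-(riemannSiegelTheta t * I)) := by
    rw [← Complex.exp_conj]; congr 1
    simp only [map_mul, Complex.conj_ofReal, Complex.conj_I]; ring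
  rw [hardyZErr, hZ, hS]
  simp only [map_add, map_mul, map_sub, hconjE]
  have : cexp (riemannSiegelTheta t * I) * (mainSum P t + D + riemannZetaChi (1 / 2 + t * I) *
      (conj (mainSum P t) + conj D) + R) =
      cexp (riemannSiegelTheta t * I) * (mainSum P t + D) +
        (cexp (riemannSiegelTheta t * I) * riemannZetaChi (1 / 2 + t * I)) * (conj (mainSum P t) + conj D)
        + cexp (riemannSiegelTheta t * I) * R := by ring
  rw [this, hχ]
  ring

/-- **Titchmarsh (9.20.6) in quantitative form.** There are `C₁ > 0` and `t₁ ≥ 2` such that for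
`t ≥ t₁` and every `P` with `2πP² ≤ t` (i.e. `P ≤ x(t) = ⌊(t/2π)^{1/2}⌋`),
`‖Z(t) − E₁(t) S_P(t) − conj(E₁(t) S_P(t))‖ ≤ 2 ‖S_{x(t)}(t) − S_P(t)‖ + C₁ t^{-1/4}`.
[cite: Titchmarsh1986, §9.20 eq. (9.20.6)] -/
theorem norm_hardyZErr_le : ∃ C₁ t₁ : ℝ, 0 < C₁ ∧ 2 ≤ t₁ ∧ ∀ (P : ℕ) (t : ℝ), t₁ ≤ t →
    2 * π * (P : ℝ) ^ 2 ≤ t →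
    ‖hardyZErr P t‖ ≤ 2 * ‖mainSum ⌊Real.sqrt (t / (2 * π))⌋₊ t - mainSum P t‖ + C₁ * t ^ (-(1 / 4 : ℝ)) := by
  obtain ⟨C, t₀, hAFE⟩ := Literature.NumberTheory.LFunctions.AFE.approxFunctionalEq_half_chi_sharp
  set K := stirlingVertRate (1 / 4) with hK
  have hK0 : 0 ≤ K := by rw [hK, stirlingVertRate]; positivity
  refine ⟨8 * K + |C| + 1, max t₀ 2, by positivity, le_max_right _ _, fun P t ht hP => ?_⟩
  have ht₀ : t₀ ≤ t := (le_max_left _ _).trans ht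
  have ht2 : 2 ≤ t := (le_max_right _ _).trans ht
  have ht0 : 0 < t := by linarith
  set x := ⌊Real.sqrt (t / (2 * π))⌋₊ with hx
  -- `P ≤ x`
  have hPx : P ≤ x := by
    rw [hx]
    refine Nat.le_floor ?_
    refine Real.le_sqrt_of_sq_le ?_
    rw [le_div_iff₀ (by positivity)]; linarith
  set E := cexp (riemannSiegelTheta t * I) with hE
  have hEn : ‖E‖ = 1 := Complex.norm_exp_ofReal_mul_I _
  set S := mainSum x t with hSdef
  set R := riemannZeta (1 / 2 + t * I) - S - riemannZetaChi (1 / 2 + t * I) * conj S with hR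
  have hRb : ‖R‖ ≤ C * t ^ (-(1 / 4 : ℝ)) := by
    have h := hAFE t ht₀
    rw [afeSum_eq_mainSum, afeSum'_eq_conj_mainSum, ← hx] at h
    exact h
  have hZ : (hardyZ t : ℂ) = E * (S + riemannZetaChi (1 / 2 + t * I) * conj S + R) := by
    rw [ofReal_hardyZ_holds t, hR]; ring
  set D := S - mainSum P t with hD
  have hSD : S = mainSum P t + D := by rw [hD]; ring
  rw [hardyZErr_eq S D R hZ hSD]
  set A := (E - thetaMainPhase t) * mainSum P t + E * D with hA
  have hconjA : ‖conj A‖ = ‖A‖ := Complex.norm_conj A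
  have hA_le : ‖A‖ ≤ 2 * K / t * (2 * Real.sqrt P) + ‖D‖ := by
    refine (norm_add_le _ _).trans (add_le_add ?_ ?_)
    · rw [norm_mul]
      exact mul_le_mul (norm_cexp_theta_sub_thetaMainPhase_le ht2) (norm_mainSum_le P t)
        (norm_nonneg _) (by positivity)
    · rw [norm_mul, hEn, one_mul]
  -- `√P ≤ t^{1/4}` and `1/t ≤ t^{-1/4} / t^{3/4} …`: we use `2K/t · 2√P ≤ 4K t^{-1/4}`
  have hsqrtP : Real.sqrt P ≤ t ^ (1 / 4 : ℝ) := by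
    have h1 : (P : ℝ) ≤ Real.sqrt t := by
      have : (P : ℝ) ^ 2 ≤ t := by nlinarith [Real.pi_gt_three, sq_nonneg (P : ℝ)]
      exact Real.le_sqrt_of_sq_le this
    calc Real.sqrt P ≤ Real.sqrt (Real.sqrt t) := Real.sqrt_le_sqrt h1
      _ = t ^ (1 / 4 : ℝ) := by
          rw [Real.sqrt_eq_rpow, Real.sqrt_eq_rpow, ← Real.rpow_mul ht0.le]; norm_num
  have hpow : t ^ (1 / 4 : ℝ) / t = t ^ (-(1 / 4 : ℝ)) * t ^ (-(1 / 2 : ℝ)) := by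
    rw [← Real.rpow_add ht0, div_eq_iff ht0.ne', ← Real.rpow_add_one ht0.ne']; norm_num
  have hthalf : t ^ (-(1 / 2 : ℝ)) ≤ 1 := Real.rpow_le_one_of_one_le_of_nonpos (by linarith) (by norm_num)
  have hq0 : 0 < t ^ (-(1 / 4 : ℝ)) := Real.rpow_pos_of_pos ht0 _
  have hterm1 : 2 * K / t * (2 * Real.sqrt P) ≤ 4 * K * t ^ (-(1 / 4 : ℝ)) := by
    calc 2 * K / t * (2 * Real.sqrt P) = 4 * K * (Real.sqrt P / t) := by ring
      _ ≤ 4 * K * (t ^ (1 / 4 : ℝ) / t) := by gcongr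
      _ = 4 * K * (t ^ (-(1 / 4 : ℝ)) * t ^ (-(1 / 2 : ℝ))) := by rw [hpow]
      _ ≤ 4 * K * (t ^ (-(1 / 4 : ℝ)) * 1) := by gcongr
      _ = 4 * K * t ^ (-(1 / 4 : ℝ)) := by ring
  have hRb' : ‖E * R‖ ≤ |C| * t ^ (-(1 / 4 : ℝ)) := by
    rw [norm_mul, hEn, one_mul]
    exact hRb.trans (mul_le_mul_of_nonneg_right (le_abs_self C) hq0.le)
  calc ‖A + conj A + E * R‖ ≤ ‖A‖ + ‖conj A‖ + ‖E * R‖ := norm_add₃_le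
    _ = 2 * ‖A‖ + ‖E * R‖ := by rw [hconjA]; ring
    _ ≤ 2 * (4 * K * t ^ (-(1 / 4 : ℝ)) + ‖D‖) + |C| * t ^ (-(1 / 4 : ℝ)) := by
        gcongr
        exact hA_le.trans (by linarith)
    _ = 2 * ‖D‖ + (8 * K + |C|) * t ^ (-(1 / 4 : ℝ)) := by ring
    _ ≤ 2 * ‖D‖ + (8 * K + |C| + 1) * t ^ (-(1 / 4 : ℝ)) := by nlinarith

/-! ### Mean values of the main sums (Montgomery–Vaughan) -/

/-- `S_k − S_P` as the conjugate of a Dirichlet polynomial `∑_{n ≤ k} c_n n^{it}`,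
`c_n = n^{-1/2} [n > P]`. [folklore] -/
theorem mainSum_sub_eq_conj_dirichletPoly (P k : ℕ) (t : ℝ) (hPk : P ≤ k) :
    mainSum k t - mainSum P t = conj (∑ n ∈ Finset.Icc 1 k,
      (if P < n then ((((n : ℝ) ^ (-(1 / 2 : ℝ)) : ℝ) : ℂ)) else 0) * (n : ℂ) ^ ((t : ℂ) * I)) := by
  rw [mainSum_sub_mainSum hPk, map_sum]
  have hsplit : Finset.Icc 1 k = Finset.Icc 1 P ∪ Finset.Icc (P + 1) k := by
    ext n; simp only [Finset.mem_union, Finset.mem_Icc]; omega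
  have hdisj : Disjoint (Finset.Icc 1 P) (Finset.Icc (P + 1) k) := by
    rw [Finset.disjoint_left]; intro n h1 h2
    simp only [Finset.mem_Icc] at h1 h2; omega
  rw [hsplit, Finset.sum_union hdisj]
  have hzero : ∑ n ∈ Finset.Icc 1 P, conj ((if P < n then ((((n : ℝ) ^ (-(1 / 2 : ℝ)) : ℝ) : ℂ)) else 0)
      * (n : ℂ) ^ ((t : ℂ) * I)) = 0 := by
    refine Finset.sum_eq_zero fun n hn => ?_
    rw [if_neg (by have := (Finset.mem_Icc.1 hn).2; omega)]; simp
  rw [hzero, zero_add]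
  refine Finset.sum_congr rfl fun n hn => ?_
  have hn1 : P < n := by have := (Finset.mem_Icc.1 hn).1; omega
  have hn0 : 0 < n := by omega
  rw [if_pos hn1, map_mul, Complex.conj_ofReal,
    natCast_cpow_mul_I_eq_cexp hn0, ← Complex.exp_conj]
  congr 2
  simp only [map_mul, Complex.conj_I, Complex.conj_ofReal]; ring

/-- **`∫_a^b |S_k − S_P|² ≤ (b − a)(k − P)/(P + 1) + 1856 (k − P)`** for `P ≤ k`, `a ≤ b`
(Montgomery–Vaughan; Titchmarsh's "proceeding as in §7.3"). [cite: Titchmarsh1986, §9.20 eq. (9.20.7)] -/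
theorem integral_norm_sq_mainSum_sub_le {P k : ℕ} (hPk : P ≤ k) {a b : ℝ} (hab : a ≤ b) :
    ∫ t in a..b, ‖mainSum k t - mainSum P t‖ ^ 2 ≤
      (b - a) * ((k - P : ℕ) : ℝ) / (P + 1) + 1856 * ((k - P : ℕ) : ℝ) := by
  set c : ℕ → ℂ := fun n => if P < n then ((((n : ℝ) ^ (-(1 / 2 : ℝ)) : ℝ) : ℂ)) else 0 with hc
  have heq : ∀ t : ℝ, ‖mainSum k t - mainSum P t‖ ^ 2 =
      ‖∑ n ∈ Finset.Icc 1 k, c n * (n : ℂ) ^ ((t : ℂ) * I)‖ ^ 2 := by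
    intro t; rw [mainSum_sub_eq_conj_dirichletPoly P k t hPk, Complex.norm_conj]
  rw [intervalIntegral.integral_congr fun t _ => heq t]
  have hMVT := abs_integral_norm_sq_dirichletPoly_sub_le k c a b
  -- the coefficient sums
  have hcn : ∀ n : ℕ, ‖c n‖ ^ 2 = if P < n then 1 / (n : ℝ) else 0 := by
    intro n
    simp only [hc]
    split_ifs with h
    · have hn0 : (0 : ℝ) < n := by exact_mod_cast (show 0 < n by omega)
      rw [Complex.norm_real, Real.norm_eq_abs, abs_of_nonneg (Real.rpow_nonneg hn0.le _),
        ← Real.rpow_natCast, ← Real.rpow_mul hn0.le]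
      norm_num
      rw [Real.rpow_neg_one]
    · simp
  have hsum1 : ∑ n ∈ Finset.Icc 1 k, ‖c n‖ ^ 2 ≤ ((k - P : ℕ) : ℝ) / (P + 1) := by
    rw [Finset.sum_congr rfl fun n _ => hcn n, ← Finset.sum_filter]
    have hfilt : (Finset.Icc 1 k).filter (fun n => P < n) = Finset.Icc (P + 1) k := by
      ext n; simp only [Finset.mem_filter, Finset.mem_Icc]; omega
    rw [hfilt]
    calc ∑ n ∈ Finset.Icc (P + 1) k, 1 / (n : ℝ) ≤ ∑ n ∈ Finset.Icc (P + 1) k, 1 / ((P : ℝ) + 1) := by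
          refine Finset.sum_le_sum fun n hn => ?_
          have : (P : ℝ) + 1 ≤ n := by exact_mod_cast (Finset.mem_Icc.1 hn).1
          exact one_div_le_one_div_of_le (by positivity) this
      _ = ((k - P : ℕ) : ℝ) / (P + 1) := by
          rw [Finset.sum_const, Nat.card_Icc, nsmul_eq_mul]
          rw [show k + 1 - (P + 1) = k - P by omega]; ring
  have hsum2 : ∑ n ∈ Finset.Icc 1 k, (n : ℝ) * ‖c n‖ ^ 2 = ((k - P : ℕ) : ℝ) := by
    rw [Finset.sum_congr rfl fun n _ => by rw [hcn n]]
    rw [show ∑ n ∈ Finset.Icc 1 k, (n : ℝ) * (if P < n then 1 / (n : ℝ) else 0) =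
        ∑ n ∈ Finset.Icc 1 k, (if P < n then (1 : ℝ) else 0) from
      Finset.sum_congr rfl fun n hn => by
        split_ifs with h
        · have hn0 : (n : ℝ) ≠ 0 := by exact_mod_cast (show n ≠ 0 by omega)
          field_simp
        · simp]
    rw [← Finset.sum_filter]
    have hfilt : (Finset.Icc 1 k).filter (fun n => P < n) = Finset.Icc (P + 1) k := by
      ext n; simp only [Finset.mem_filter, Finset.mem_Icc]; omega
    rw [hfilt, Finset.sum_const, Nat.card_Icc, nsmul_eq_mul, mul_one]
    congr 1; omega
  have hsum0 : 0 ≤ ∑ n ∈ Finset.Icc 1 k, ‖c n‖ ^ 2 := Finset.sum_nonneg fun n _ => by positivity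
  rw [hsum2] at hMVT
  have h := (abs_le.1 hMVT).2
  have hba : 0 ≤ b - a := by linarith
  calc ∫ t in a..b, ‖∑ n ∈ Finset.Icc 1 k, c n * (n : ℂ) ^ ((t : ℂ) * I)‖ ^ 2
      ≤ (b - a) * ∑ n ∈ Finset.Icc 1 k, ‖c n‖ ^ 2 + 1856 * ((k - P : ℕ) : ℝ) := by linarith
    _ ≤ (b - a) * (((k - P : ℕ) : ℝ) / (P + 1)) + 1856 * ((k - P : ℕ) : ℝ) := by gcongr
    _ = _ := by ring

/-- **`∫_a^b |S_P|² ≤ (b − a)(1 + log P) + 1856 P`** (`a ≤ b`). [cite: Titchmarsh1986, §7.3] -/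
theorem integral_norm_sq_mainSum_le (P : ℕ) {a b : ℝ} (hab : a ≤ b) :
    ∫ t in a..b, ‖mainSum P t‖ ^ 2 ≤ (b - a) * (1 + Real.log P) + 1856 * P := by
  have h0 : ∀ t, mainSum P t = mainSum P t - mainSum 0 t := fun t => by simp [mainSum]
  set c : ℕ → ℂ := fun n => if 0 < n then ((((n : ℝ) ^ (-(1 / 2 : ℝ)) : ℝ) : ℂ)) else 0 with hc
  have heq : ∀ t : ℝ, ‖mainSum P t‖ ^ 2 = ‖∑ n ∈ Finset.Icc 1 P, c n * (n : ℂ) ^ ((t : ℂ) * I)‖ ^ 2 := by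
    intro t; rw [h0 t, mainSum_sub_eq_conj_dirichletPoly 0 P t (Nat.zero_le P), Complex.norm_conj]
  rw [intervalIntegral.integral_congr fun t _ => heq t]
  have hMVT := abs_integral_norm_sq_dirichletPoly_sub_le P c a b
  have hcn : ∀ n ∈ Finset.Icc 1 P, ‖c n‖ ^ 2 = 1 / (n : ℝ) := by
    intro n hn
    have hn : 0 < n := (Finset.mem_Icc.1 hn).1
    have hn0 : (0 : ℝ) < n := by exact_mod_cast hn
    simp only [hc, if_pos hn]
    rw [Complex.norm_real, Real.norm_eq_abs, abs_of_nonneg (Real.rpow_nonneg hn0.le _),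
      ← Real.rpow_natCast, ← Real.rpow_mul hn0.le]
    norm_num
    rw [Real.rpow_neg_one]
  have hsum1 : ∑ n ∈ Finset.Icc 1 P, ‖c n‖ ^ 2 ≤ 1 + Real.log P := by
    rw [Finset.sum_congr rfl hcn]
    exact Literature.NumberTheory.Sieve.sum_Icc_one_div_le_one_add_log P
  have hsum2 : ∑ n ∈ Finset.Icc 1 P, (n : ℝ) * ‖c n‖ ^ 2 = P := by
    rw [Finset.sum_congr rfl fun n hn => by
      rw [hcn n hn, show (n : ℝ) * (1 / n) = 1 by
        have : (n : ℝ) ≠ 0 := by exact_mod_cast (show n ≠ 0 by have := (Finset.mem_Icc.1 hn).1; omega)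
        field_simp]]
    simp
  rw [hsum2] at hMVT
  have h := (abs_le.1 hMVT).2
  have hba : 0 ≤ b - a := by linarith
  calc ∫ t in a..b, ‖∑ n ∈ Finset.Icc 1 P, c n * (n : ℂ) ^ ((t : ℂ) * I)‖ ^ 2
      ≤ (b - a) * ∑ n ∈ Finset.Icc 1 P, ‖c n‖ ^ 2 + 1856 * P := by linarith
    _ ≤ (b - a) * (1 + Real.log P) + 1856 * P := by gcongr

/-! ### The mean square of `e` on `[T, T₂]`: Titchmarsh's (9.20.7) -/

/-- `√(T₂/2π) − √(T/2π) ≤ (T₂ − T)/(5 √T)` for `0 < T ≤ T₂`. [folklore] -/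
theorem sqrt_div_two_pi_sub_le {T T₂ : ℝ} (hT : 0 < T) (hTT₂ : T ≤ T₂) :
    Real.sqrt (T₂ / (2 * π)) - Real.sqrt (T / (2 * π)) ≤ (T₂ - T) / (5 * Real.sqrt T) := by
  have h2π : (0 : ℝ) < 2 * π := by positivity
  set b := T / (2 * π) with hb
  set a := T₂ / (2 * π) with ha
  have hb0 : 0 < b := by positivity
  have hab : b ≤ a := div_le_div_of_nonneg_right hTT₂ h2π.le
  have hsb : 0 < Real.sqrt b := Real.sqrt_pos.2 hb0
  set d := (a - b) / (2 * Real.sqrt b) with hd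
  have hd0 : 0 ≤ d := by positivity
  -- `√a ≤ √b + d` since `(√b + d)² = a + d² ≥ a`
  have hsq : (Real.sqrt b + d) ^ 2 = a + d ^ 2 := by
    have : 2 * Real.sqrt b * d = a - b := by rw [hd]; field_simp
    nlinarith [Real.sq_sqrt hb0.le]
  have h1 : Real.sqrt a ≤ Real.sqrt b + d := by
    rw [← Real.sqrt_sq (by positivity : 0 ≤ Real.sqrt b + d), hsq]
    exact Real.sqrt_le_sqrt (by nlinarith)
  -- `d = (T₂ − T)/(4π √(T/2π)) = (T₂−T) √(2π)/(4π √T) ≤ (T₂−T)/(5√T)`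
  have hsbT : Real.sqrt b = Real.sqrt T / Real.sqrt (2 * π) := by rw [hb, Real.sqrt_div' T h2π.le]
  have hd_le : d ≤ (T₂ - T) / (5 * Real.sqrt T) := by
    rw [hd, ha, hb, hsbT]
    have hsT : 0 < Real.sqrt T := Real.sqrt_pos.2 hT
    have hs2π : 0 < Real.sqrt (2 * π) := Real.sqrt_pos.2 h2π
    rw [div_le_div_iff₀ (by positivity) (by positivity)]
    -- `(T₂/2π − T/2π) · 5√T ≤ (T₂ − T) · 2 (√T/√(2π))`, i.e. `5 √(2π) ≤ 4π`
    have hU : 0 ≤ T₂ - T := by linarith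
    have hkey : 5 * Real.sqrt (2 * π) ≤ 4 * π := by
      have hπ : (3.14 : ℝ) < π := Real.pi_gt_d2
      have : Real.sqrt (2 * π) ≤ 4 * π / 5 := by
        rw [Real.sqrt_le_left (by positivity)]
        nlinarith [mul_pos Real.pi_pos (show (0 : ℝ) < 16 * π / 25 - 2 by linarith)]
      linarith
    have e1 : (T₂ / (2 * π) - T / (2 * π)) * (5 * Real.sqrt T) = (T₂ - T) * Real.sqrt T * (5 / (2 * π)) := by
      field_simp
    have e2 : (T₂ - T) * (2 * (Real.sqrt T / Real.sqrt (2 * π))) =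
        (T₂ - T) * Real.sqrt T * (2 / Real.sqrt (2 * π)) := by ring
    rw [e1, e2]
    refine mul_le_mul_of_nonneg_left ?_ (by positivity)
    rw [div_le_div_iff₀ h2π hs2π]
    nlinarith [Real.mul_self_sqrt h2π.le, hs2π]
  linarith

/-- `2π ⌊√(T/2π)⌋² ≤ T` for `T ≥ 0`. [folklore] -/
theorem two_pi_mul_floor_sq_le {T : ℝ} (hT : 0 ≤ T) :
    2 * π * (⌊Real.sqrt (T / (2 * π))⌋₊ : ℝ) ^ 2 ≤ T := by
  have h2π : (0 : ℝ) < 2 * π := by positivity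
  have h1 : (⌊Real.sqrt (T / (2 * π))⌋₊ : ℝ) ≤ Real.sqrt (T / (2 * π)) := Nat.floor_le (Real.sqrt_nonneg _)
  have h2 : (⌊Real.sqrt (T / (2 * π))⌋₊ : ℝ) ^ 2 ≤ T / (2 * π) := by
    calc (⌊Real.sqrt (T / (2 * π))⌋₊ : ℝ) ^ 2 ≤ Real.sqrt (T / (2 * π)) ^ 2 := by gcongr
      _ = T / (2 * π) := Real.sq_sqrt (by positivity)
  rw [le_div_iff₀ h2π] at h2; linarith

/-- `T < 2π (⌊√(T/2π)⌋ + 1)²` for `T ≥ 0`. [folklore] -/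
theorem lt_two_pi_mul_floor_add_one_sq {T : ℝ} (hT : 0 ≤ T) :
    T < 2 * π * ((⌊Real.sqrt (T / (2 * π))⌋₊ : ℝ) + 1) ^ 2 := by
  have h2π : (0 : ℝ) < 2 * π := by positivity
  have h1 : Real.sqrt (T / (2 * π)) < (⌊Real.sqrt (T / (2 * π))⌋₊ : ℝ) + 1 := Nat.lt_floor_add_one _
  have h2 : T / (2 * π) < ((⌊Real.sqrt (T / (2 * π))⌋₊ : ℝ) + 1) ^ 2 := by
    calc T / (2 * π) = Real.sqrt (T / (2 * π)) ^ 2 := (Real.sq_sqrt (by positivity)).symm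
      _ < ((⌊Real.sqrt (T / (2 * π))⌋₊ : ℝ) + 1) ^ 2 := by gcongr
  rw [div_lt_iff₀ h2π] at h2; linarith

/-- `2πk² ≤ t ⇒ k ≤ ⌊√(t/2π)⌋`. [folklore] -/
theorem le_floor_sqrt_of_sq_le {t : ℝ} {k : ℕ} (h : 2 * π * (k : ℝ) ^ 2 ≤ t) :
    k ≤ ⌊Real.sqrt (t / (2 * π))⌋₊ := by
  refine Nat.le_floor (Real.le_sqrt_of_sq_le ?_)
  rw [le_div_iff₀ (by positivity)]; linarith

/-- `t ≤ 2π(k+1)² ⇒ ⌊√(t/2π)⌋ ≤ k + 1`. [folklore] -/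
theorem floor_sqrt_le_of_le_sq {t : ℝ} {k : ℕ} (h : t ≤ 2 * π * ((k : ℝ) + 1) ^ 2) :
    ⌊Real.sqrt (t / (2 * π))⌋₊ ≤ k + 1 := by
  have h2π : (0 : ℝ) < 2 * π := by positivity
  have h1 : Real.sqrt (t / (2 * π)) ≤ (k : ℝ) + 1 := by
    rw [Real.sqrt_le_left (by positivity), div_le_iff₀ h2π]; linarith
  have : ⌊Real.sqrt (t / (2 * π))⌋₊ ≤ ⌊((k + 1 : ℕ) : ℝ)⌋₊ := Nat.floor_mono (by push_cast; exact h1)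
  rwa [Nat.floor_natCast] at this

/-- Continuity of `t ↦ E₁(t)` on `(0, ∞)`. [folklore] -/
theorem continuousOn_thetaMainPhase : ContinuousOn thetaMainPhase (Set.Ioi 0) := by
  refine Complex.continuous_exp.comp_continuousOn ?_
  refine (continuous_const.mul Complex.continuous_ofReal).comp_continuousOn ?_
  refine ((ContinuousOn.mul (continuousOn_id.div_const 2) ?_).sub (continuousOn_id.div_const 2)).sub
    continuousOn_const
  exact Real.continuousOn_log.comp (continuousOn_id.div_const _) fun t ht =>
    div_ne_zero (ne_of_gt ht) (by positivity)

/-- Continuity of `t ↦ S_P(t)`. [folklore] -/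
theorem continuous_mainSum (P : ℕ) : Continuous (mainSum P) := by
  unfold mainSum
  refine continuous_finsetSum _ fun n _ => continuous_const.mul (Complex.continuous_exp.comp ?_)
  exact ((continuous_const.mul Complex.continuous_ofReal).mul continuous_const).neg

/-- Continuity of `t ↦ ‖e(t)‖²` on `(0, ∞)`. [folklore] -/
theorem continuousOn_norm_sq_hardyZErr (P : ℕ) :
    ContinuousOn (fun t => ‖hardyZErr P t‖ ^ 2) (Set.Ioi 0) := by
  have hz : ContinuousOn (fun t => thetaMainPhase t * mainSum P t) (Set.Ioi 0) :=
    continuousOn_thetaMainPhase.mul (continuous_mainSum P).continuousOn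
  have h : ContinuousOn (hardyZErr P) (Set.Ioi 0) := by
    unfold hardyZErr
    refine ((Complex.continuous_ofReal.comp continuous_hardyZ).continuousOn.sub hz).sub ?_
    exact (Complex.continuous_conj.comp_continuousOn hz)
  exact (h.norm).pow 2

/-- The pointwise bound on a segment: if `‖e‖ ≤ 2‖D_x‖ + C₁ t^{-1/4}` with `x ∈ {k, k+1}`, then
`‖e‖² ≤ 8‖D_k‖² + 8‖D_{k+1}‖² + 2 C₁² t^{-1/2}`. [folklore] -/
theorem norm_sq_hardyZErr_le_of_seg {P k x : ℕ} {t C₁ : ℝ} (ht : 0 < t) (hC₁ : 0 ≤ C₁)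
    (hx : x = k ∨ x = k + 1)
    (he : ‖hardyZErr P t‖ ≤ 2 * ‖mainSum x t - mainSum P t‖ + C₁ * t ^ (-(1 / 4 : ℝ))) :
    ‖hardyZErr P t‖ ^ 2 ≤ 8 * ‖mainSum k t - mainSum P t‖ ^ 2 + 8 * ‖mainSum (k + 1) t - mainSum P t‖ ^ 2
      + 2 * C₁ ^ 2 * t ^ (-(1 / 2 : ℝ)) := by
  set d := ‖mainSum x t - mainSum P t‖ with hd
  set c := C₁ * t ^ (-(1 / 4 : ℝ)) with hc
  have hc0 : 0 ≤ c := by positivity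
  have hd0 : 0 ≤ d := norm_nonneg _
  have h1 : ‖hardyZErr P t‖ ^ 2 ≤ (2 * d + c) ^ 2 := by
    exact pow_le_pow_left₀ (norm_nonneg _) he 2
  have h2 : (2 * d + c) ^ 2 ≤ 8 * d ^ 2 + 2 * c ^ 2 := by nlinarith [sq_nonneg (2 * d - c)]
  have hc2 : c ^ 2 = C₁ ^ 2 * t ^ (-(1 / 2 : ℝ)) := by
    rw [hc, mul_pow]
    congr 1
    rw [← Real.rpow_natCast, ← Real.rpow_mul ht.le]; norm_num
  have hd2 : d ^ 2 ≤ ‖mainSum k t - mainSum P t‖ ^ 2 + ‖mainSum (k + 1) t - mainSum P t‖ ^ 2 := by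
    rcases hx with rfl | rfl
    · exact le_add_of_nonneg_right (by positivity)
    · exact le_add_of_nonneg_left (by positivity)
  nlinarith

/-- **The segment bound.** With `s_j = max(T, min(T₂, 2π(P+j)²))`, on `[s_j, s_{j+1}]` the
cut-off `x(t)` is `P + j` or `P + j + 1`, so
`∫_{s_j}^{s_{j+1}} |e|² ≤ 8 M_j + 8 M_{j+1} + 2 C₁² (s_{j+1} − s_j)/√T`,
`M_i = (s_{j+1} − s_j) i/(P+1) + 1856 i` (Montgomery–Vaughan on each piece).
[cite: Titchmarsh1986, §9.20 eq. (9.20.7)] -/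
theorem integral_norm_sq_hardyZErr_seg_le {C₁ t₁ : ℝ} (hC₁ : 0 < C₁) (ht₁ : 2 ≤ t₁)
    (hpt : ∀ (P : ℕ) (t : ℝ), t₁ ≤ t → 2 * π * (P : ℝ) ^ 2 ≤ t →
      ‖hardyZErr P t‖ ≤ 2 * ‖mainSum ⌊Real.sqrt (t / (2 * π))⌋₊ t - mainSum P t‖ + C₁ * t ^ (-(1 / 4 : ℝ)))
    {T T₂ : ℝ} {P : ℕ} (hT : t₁ ≤ T) (hTT₂ : T ≤ T₂) (hPT : 2 * π * (P : ℝ) ^ 2 ≤ T)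
    (hTP : T < 2 * π * ((P : ℝ) + 1) ^ 2) (j : ℕ) :
    ∫ t in max T (min T₂ (2 * π * ((P : ℝ) + j) ^ 2))..max T (min T₂ (2 * π * ((P : ℝ) + j + 1) ^ 2)),
        ‖hardyZErr P t‖ ^ 2 ≤
      8 * ((max T (min T₂ (2 * π * ((P : ℝ) + j + 1) ^ 2)) - max T (min T₂ (2 * π * ((P : ℝ) + j) ^ 2)))
              * j / ((P : ℝ) + 1) + 1856 * j)
      + 8 * ((max T (min T₂ (2 * π * ((P : ℝ) + j + 1) ^ 2)) - max T (min T₂ (2 * π * ((P : ℝ) + j) ^ 2)))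
              * (j + 1) / ((P : ℝ) + 1) + 1856 * (j + 1))
      + 2 * C₁ ^ 2 * ((max T (min T₂ (2 * π * ((P : ℝ) + j + 1) ^ 2))
          - max T (min T₂ (2 * π * ((P : ℝ) + j) ^ 2)))) / Real.sqrt T := by
  have hT0 : 0 < T := by linarith
  set lo := max T (min T₂ (2 * π * ((P : ℝ) + j) ^ 2)) with hlo
  set hi := max T (min T₂ (2 * π * ((P : ℝ) + j + 1) ^ 2)) with hhi
  have hsq_mono : 2 * π * ((P : ℝ) + j) ^ 2 ≤ 2 * π * ((P : ℝ) + j + 1) ^ 2 := by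
    have h0 : (0 : ℝ) ≤ (P : ℝ) + j := by positivity
    have : ((P : ℝ) + j) ^ 2 ≤ ((P : ℝ) + j + 1) ^ 2 := pow_le_pow_left₀ h0 (by linarith) 2
    exact mul_le_mul_of_nonneg_left this (by positivity)
  have hlohi : lo ≤ hi := max_le_max le_rfl (min_le_min le_rfl hsq_mono)
  have hloT : T ≤ lo := le_max_left _ _
  have hhiT₂ : hi ≤ T₂ := max_le hTT₂ (min_le_left _ _)
  have hΔ0 : 0 ≤ hi - lo := by linarith
  have hRHS0 : 0 ≤ 8 * ((hi - lo) * j / ((P : ℝ) + 1) + 1856 * j)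
      + 8 * ((hi - lo) * (j + 1) / ((P : ℝ) + 1) + 1856 * (j + 1)) + 2 * C₁ ^ 2 * (hi - lo) / Real.sqrt T := by
    positivity
  rcases eq_or_lt_of_le hlohi with heq | hlt
  · rw [← heq, intervalIntegral.integral_same]; rw [← heq] at hRHS0; simpa using hRHS0
  -- non-degenerate segment: `2π(P+j)² < T₂`, so `lo = max T (2π(P+j)²)`
  have h2 : 2 * π * ((P : ℝ) + j) ^ 2 < T₂ := by
    by_contra h
    push Not at h
    have : lo = T₂ := by
      rw [hlo, min_eq_left h, max_eq_right hTT₂]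
    linarith
  have hlo' : lo = max T (2 * π * ((P : ℝ) + j) ^ 2) := by rw [hlo, min_eq_right h2.le]
  have hhi' : hi ≤ 2 * π * ((P : ℝ) + j + 1) ^ 2 := by
    refine max_le ?_ (min_le_right _ _)
    refine hTP.le.trans ?_
    have hj : (0 : ℝ) ≤ j := Nat.cast_nonneg j
    have : ((P : ℝ) + 1) ^ 2 ≤ ((P : ℝ) + j + 1) ^ 2 := pow_le_pow_left₀ (by positivity) (by linarith) 2
    exact mul_le_mul_of_nonneg_left this (by positivity)
  -- pointwise bound on the segment
  have hptw : ∀ t ∈ Set.Icc lo hi, ‖hardyZErr P t‖ ^ 2 ≤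
      8 * ‖mainSum (P + j) t - mainSum P t‖ ^ 2 + 8 * ‖mainSum (P + j + 1) t - mainSum P t‖ ^ 2
        + 2 * C₁ ^ 2 / Real.sqrt T := by
    intro t ht
    have htT : T ≤ t := hloT.trans ht.1
    have ht0 : 0 < t := hT0.trans_le htT
    have hlow : 2 * π * (((P + j : ℕ) : ℝ)) ^ 2 ≤ t := by
      push_cast; exact ((le_max_right _ _).trans_eq hlo'.symm).trans ht.1
    have hup : t ≤ 2 * π * (((P + j : ℕ) : ℝ) + 1) ^ 2 := by
      push_cast; linarith [ht.2]
    have hx1 := le_floor_sqrt_of_sq_le hlow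
    have hx2 := floor_sqrt_le_of_le_sq hup
    have hx : ⌊Real.sqrt (t / (2 * π))⌋₊ = P + j ∨ ⌊Real.sqrt (t / (2 * π))⌋₊ = P + j + 1 := by omega
    have he := hpt P t (hT.trans htT) (hPT.trans htT)
    have h := norm_sq_hardyZErr_le_of_seg (k := P + j) ht0 hC₁.le hx he
    have htpow : t ^ (-(1 / 2 : ℝ)) ≤ 1 / Real.sqrt T := by
      rw [Real.rpow_neg ht0.le, ← Real.sqrt_eq_rpow, one_div]
      exact inv_anti₀ (Real.sqrt_pos.2 hT0) (Real.sqrt_le_sqrt htT)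
    have : 2 * C₁ ^ 2 * t ^ (-(1 / 2 : ℝ)) ≤ 2 * C₁ ^ 2 / Real.sqrt T :=
      calc 2 * C₁ ^ 2 * t ^ (-(1 / 2 : ℝ)) ≤ 2 * C₁ ^ 2 * (1 / Real.sqrt T) :=
            mul_le_mul_of_nonneg_left htpow (by positivity)
        _ = 2 * C₁ ^ 2 / Real.sqrt T := by ring
    linarith
  -- integrate
  have hcontL : ContinuousOn (fun t => ‖hardyZErr P t‖ ^ 2) (Set.uIcc lo hi) :=
    (continuousOn_norm_sq_hardyZErr P).mono fun t ht => by
      rw [Set.uIcc_of_le hlohi] at ht; exact hT0.trans_le (hloT.trans ht.1)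
  have hcontD : ∀ k, Continuous fun t => ‖mainSum k t - mainSum P t‖ ^ 2 := fun k =>
    (((continuous_mainSum k).sub (continuous_mainSum P)).norm).pow 2
  have hc8a : Continuous fun t => 8 * ‖mainSum (P + j) t - mainSum P t‖ ^ 2 :=
    continuous_const.mul (hcontD (P + j))
  have hc8b : Continuous fun t => 8 * ‖mainSum (P + j + 1) t - mainSum P t‖ ^ 2 :=
    continuous_const.mul (hcontD (P + j + 1))
  have hintR : IntervalIntegrable (fun t => 8 * ‖mainSum (P + j) t - mainSum P t‖ ^ 2
      + 8 * ‖mainSum (P + j + 1) t - mainSum P t‖ ^ 2 + 2 * C₁ ^ 2 / Real.sqrt T) volume lo hi :=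
    ((hc8a.add hc8b).add continuous_const).intervalIntegrable _ _
  have hmono := intervalIntegral.integral_mono_on hlohi (hcontL.intervalIntegrable) hintR hptw
  refine hmono.trans ?_
  have hI1 := integral_norm_sq_mainSum_sub_le (P := P) (k := P + j) (by omega) hlohi
  have hI2 := integral_norm_sq_mainSum_sub_le (P := P) (k := P + j + 1) (by omega) hlohi
  rw [show P + j - P = j by omega] at hI1
  rw [show P + j + 1 - P = j + 1 by omega] at hI2
  rw [intervalIntegral.integral_add, intervalIntegral.integral_add, intervalIntegral.integral_const_mul,
    intervalIntegral.integral_const_mul, intervalIntegral.integral_const, smul_eq_mul]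
  · push_cast at hI2 ⊢
    have e : (hi - lo) * (2 * C₁ ^ 2 / Real.sqrt T) = 2 * C₁ ^ 2 * (hi - lo) / Real.sqrt T := by ring
    linarith [hI1, hI2, e]
  · exact hc8a.intervalIntegrable _ _
  · exact hc8b.intervalIntegrable _ _
  · exact (hc8a.add hc8b).intervalIntegrable _ _
  · exact intervalIntegrable_const

/-- The numerics of (9.20.7): with `J ≤ U/(5√T) + 2`, `1/(P+1) ≤ 2.6/√T`,
`16 U J/(P+1) + 29696 J² + 2 C₁² U/√T ≤ (240100 + 2C₁²)(1 + U/√T + U²/T)`. [folklore] -/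
theorem meanSquare_numerics {U T J q C₁ : ℝ} (hU : 0 ≤ U) (hT : 0 < T) (hJ0 : 0 ≤ J)
    (hJ : J ≤ U / (5 * Real.sqrt T) + 2) (hq0 : 0 ≤ q) (hq : q ≤ 2.6 / Real.sqrt T) :
    16 * U * J * q + 29696 * J ^ 2 + 2 * C₁ ^ 2 * U / Real.sqrt T ≤
      (240100 + 2 * C₁ ^ 2) * (1 + U / Real.sqrt T + U ^ 2 / T) := by
  have hsT : 0 < Real.sqrt T := Real.sqrt_pos.2 hT
  set u := U / Real.sqrt T with hu
  have hu0 : 0 ≤ u := by positivity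
  have hu2 : U ^ 2 / T = u ^ 2 := by
    rw [hu, div_pow, Real.sq_sqrt hT.le]
  have e : U / (5 * Real.sqrt T) = u / 5 := by rw [hu, div_div, mul_comm]
  have hJ' : J ≤ u / 5 + 2 := by rw [← e]; exact hJ
  have h1 : 16 * U * J * q ≤ 16 * U * (u / 5 + 2) * (2.6 / Real.sqrt T) := by
    have : 16 * U * J ≤ 16 * U * (u / 5 + 2) := by nlinarith
    calc 16 * U * J * q ≤ 16 * U * (u / 5 + 2) * q := mul_le_mul_of_nonneg_right this hq0
      _ ≤ 16 * U * (u / 5 + 2) * (2.6 / Real.sqrt T) := mul_le_mul_of_nonneg_left hq (by positivity)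
  have h1' : 16 * U * (u / 5 + 2) * (2.6 / Real.sqrt T) = 8.32 * u ^ 2 + 83.2 * u := by
    rw [hu]; field_simp; ring
  have h2 : 29696 * J ^ 2 ≤ 29696 * (2 * (u / 5) ^ 2 + 8) := by
    have : J ^ 2 ≤ (u / 5 + 2) ^ 2 := pow_le_pow_left₀ hJ0 hJ' 2
    nlinarith [sq_nonneg (u / 5 - 2)]
  have h3 : 2 * C₁ ^ 2 * U / Real.sqrt T = 2 * C₁ ^ 2 * u := by rw [hu]; ring
  rw [hu2, h3]
  have hC : 2 * C₁ ^ 2 * u ≤ 2 * C₁ ^ 2 * (1 + u + u ^ 2) := by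
    have : 0 ≤ 2 * C₁ ^ 2 * (1 + u ^ 2) := by positivity
    nlinarith
  nlinarith [h1, h1', h2, hC, sq_nonneg u, hu0]

/-- **Titchmarsh (9.20.7): the mean square of `e = Z − z₁ − z̄₁`.** There are `C₂ > 0` and
`T₁ ≥ 2` such that for `T₁ ≤ T ≤ T₂`, with `P = ⌊(T/2π)^{1/2}⌋`,
`∫_T^{T₂} |Z(t) − E₁(t)S_P(t) − conj(E₁(t)S_P(t))|² dt ≤ C₂ (1 + U/√T + U²/T)`, `U = T₂ − T`
(printed: `∫_T^{T+U} |z − z₁|² dt = O(U²/T) + O(T^{1/2} log T)`; here with the `O(t^{-1/4})` term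
of (9.20.6) included and the sharper Montgomery–Vaughan off-diagonal bound).
[cite: Titchmarsh1986, §9.20 eq. (9.20.7)] -/
theorem integral_norm_sq_hardyZErr_le : ∃ C₂ T₁ : ℝ, 0 < C₂ ∧ 2 ≤ T₁ ∧ ∀ T T₂ : ℝ, T₁ ≤ T → T ≤ T₂ →
    ∫ t in T..T₂, ‖hardyZErr ⌊Real.sqrt (T / (2 * π))⌋₊ t‖ ^ 2 ≤
      (C₂) * (1 + (T₂ - T) / Real.sqrt T + (T₂ - T) ^ 2 / T) := by
  obtain ⟨C₁, t₁, hC₁, ht₁, hpt⟩ := norm_hardyZErr_le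
  refine ⟨240100 + 2 * C₁ ^ 2, t₁, by positivity, ht₁, fun T T₂ hT hTT₂ => ?_⟩
  have hT0 : 0 < T := by linarith
  have hT₂0 : 0 ≤ T₂ := by linarith
  set P := ⌊Real.sqrt (T / (2 * π))⌋₊ with hP
  set P' := ⌊Real.sqrt (T₂ / (2 * π))⌋₊ with hP'
  have hPP' : P ≤ P' := Nat.floor_mono (Real.sqrt_le_sqrt (div_le_div_of_nonneg_right hTT₂ (by positivity)))
  set J := P' - P + 1 with hJ
  have hPT : 2 * π * (P : ℝ) ^ 2 ≤ T := two_pi_mul_floor_sq_le hT0.le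
  have hTP : T < 2 * π * ((P : ℝ) + 1) ^ 2 := lt_two_pi_mul_floor_add_one_sq hT0.le
  have hT₂P' : T₂ < 2 * π * ((P' : ℝ) + 1) ^ 2 := lt_two_pi_mul_floor_add_one_sq hT₂0
  set s : ℕ → ℝ := fun j => max T (min T₂ (2 * π * ((P : ℝ) + j) ^ 2)) with hs
  have hs0 : s 0 = T := by
    simp only [hs, Nat.cast_zero, add_zero]
    exact max_eq_left ((min_le_right _ _).trans hPT)
  have hsJ : s J = T₂ := by
    simp only [hs]
    have : ((P : ℝ) + (J : ℕ)) = (P' : ℝ) + 1 := by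
      rw [hJ]; push_cast [Nat.cast_sub hPP']; ring
    rw [this, min_eq_left hT₂P'.le, max_eq_right hTT₂]
  have hs_succ : ∀ j : ℕ, s (j + 1) = max T (min T₂ (2 * π * ((P : ℝ) + j + 1) ^ 2)) := by
    intro j; simp only [hs]; push_cast; ring_nf
  have hs_mem : ∀ j, T ≤ s j ∧ s j ≤ T₂ := fun j =>
    ⟨le_max_left _ _, max_le hTT₂ (min_le_left _ _)⟩
  -- integrability on each segment
  have hint : ∀ k < J, IntervalIntegrable (fun t => ‖hardyZErr P t‖ ^ 2) volume (s k) (s (k + 1)) := by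
    intro k _
    refine ((continuousOn_norm_sq_hardyZErr P).mono fun t ht => ?_).intervalIntegrable
    have h1 := (hs_mem k).1; have h2 := (hs_mem (k + 1)).1
    rcases Set.mem_uIcc.1 ht with h | h
    · exact hT0.trans_le (h1.trans h.1)
    · exact hT0.trans_le (h2.trans h.1)
  have hsum := intervalIntegral.sum_integral_adjacent_intervals hint
  rw [hs0, hsJ] at hsum
  rw [← hsum]
  -- bound each segment
  have hseg : ∀ k ∈ Finset.range J, ∫ t in s k..s (k + 1), ‖hardyZErr P t‖ ^ 2 ≤
      16 * (s (k + 1) - s k) * J / ((P : ℝ) + 1) + 29696 * J + 2 * C₁ ^ 2 * (s (k + 1) - s k) / Real.sqrt T := by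
    intro k hk
    have hkJ : (k : ℝ) + 1 ≤ J := by exact_mod_cast Finset.mem_range.1 hk
    have h := integral_norm_sq_hardyZErr_seg_le hC₁ ht₁ hpt hT hTT₂ hPT hTP k
    rw [← hs_succ k] at h
    have hsk : s k = max T (min T₂ (2 * π * ((P : ℝ) + k) ^ 2)) := rfl
    rw [← hsk] at h
    refine h.trans ?_
    have hΔ : 0 ≤ s (k + 1) - s k := by
      rw [hs_succ, hsk]
      refine sub_nonneg.2 (max_le_max le_rfl (min_le_min le_rfl ?_))
      have h0 : (0 : ℝ) ≤ (P : ℝ) + k := by positivity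
      exact mul_le_mul_of_nonneg_left (pow_le_pow_left₀ h0 (by linarith) 2) (by positivity)
    have hP1 : (0 : ℝ) < (P : ℝ) + 1 := by positivity
    have hk0 : (0 : ℝ) ≤ k := Nat.cast_nonneg k
    -- `k, k+1 ≤ J`
    have e1 : (s (k + 1) - s k) * k / ((P : ℝ) + 1) ≤ (s (k + 1) - s k) * J / ((P : ℝ) + 1) :=
      div_le_div_of_nonneg_right (mul_le_mul_of_nonneg_left (by linarith) hΔ) hP1.le
    have e2 : (s (k + 1) - s k) * (k + 1) / ((P : ℝ) + 1) ≤ (s (k + 1) - s k) * J / ((P : ℝ) + 1) :=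
      div_le_div_of_nonneg_right (mul_le_mul_of_nonneg_left hkJ hΔ) hP1.le
    have e3 : 16 * (s (k + 1) - s k) * J / ((P : ℝ) + 1) = 16 * ((s (k + 1) - s k) * J / ((P : ℝ) + 1)) := by
      ring
    linarith [e1, e2, e3]
  refine (Finset.sum_le_sum hseg).trans ?_
  rw [Finset.sum_add_distrib, Finset.sum_add_distrib, Finset.sum_const, Finset.card_range, nsmul_eq_mul]
  have htel : ∑ k ∈ Finset.range J, (s (k + 1) - s k) = T₂ - T := by
    rw [Finset.sum_range_sub, hs0, hsJ]
  have hsum1 : ∑ k ∈ Finset.range J, 16 * (s (k + 1) - s k) * J / ((P : ℝ) + 1) =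
      16 * (T₂ - T) * J * (1 / ((P : ℝ) + 1)) := by
    rw [← htel, Finset.mul_sum, Finset.sum_mul, Finset.sum_mul]
    refine Finset.sum_congr rfl fun k _ => by ring
  have hsum3 : ∑ k ∈ Finset.range J, 2 * C₁ ^ 2 * (s (k + 1) - s k) / Real.sqrt T =
      2 * C₁ ^ 2 * (T₂ - T) / Real.sqrt T := by
    rw [← htel, Finset.mul_sum, Finset.sum_div]
  rw [hsum1, hsum3, show (J : ℝ) * (29696 * J) = 29696 * (J : ℝ) ^ 2 by ring]
  -- numerics
  have hU : 0 ≤ T₂ - T := by linarith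
  have hJle : (J : ℝ) ≤ (T₂ - T) / (5 * Real.sqrt T) + 2 := by
    have hP'le : (P' : ℝ) ≤ Real.sqrt (T₂ / (2 * π)) := Nat.floor_le (Real.sqrt_nonneg _)
    have hPgt : Real.sqrt (T / (2 * π)) < (P : ℝ) + 1 := Nat.lt_floor_add_one _
    have hdiff := sqrt_div_two_pi_sub_le hT0 hTT₂
    have : (J : ℝ) = (P' : ℝ) - P + 1 := by
      rw [hJ]; push_cast [Nat.cast_sub hPP']; ring
    rw [this]; linarith
  have hq : 1 / ((P : ℝ) + 1) ≤ 2.6 / Real.sqrt T := by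
    have hPgt : Real.sqrt (T / (2 * π)) < (P : ℝ) + 1 := Nat.lt_floor_add_one _
    have hsT : 0 < Real.sqrt T := Real.sqrt_pos.2 hT0
    rw [div_le_div_iff₀ (by positivity) hsT, one_mul]
    have h26 : Real.sqrt T ≤ 2.6 * Real.sqrt (T / (2 * π)) := by
      rw [Real.sqrt_div' T (by positivity), mul_div_assoc', le_div_iff₀ (Real.sqrt_pos.2 (by positivity))]
      have : Real.sqrt (2 * π) ≤ 2.6 := by
        rw [Real.sqrt_le_left (by norm_num)]
        nlinarith [Real.pi_lt_d2]
      nlinarith [Real.sqrt_nonneg T]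
    nlinarith
  exact meanSquare_numerics (C₁ := C₁) hU hT0 (Nat.cast_nonneg J) hJle (by positivity) hq

end Literature.NumberTheory.LFunctions.TwistedMoment
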